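import Summits.AtomisticToContinuum.HydrodynamicLimit.Theorems.ImplosionDichotomyDenseExcursionR2AdmissibleData
import Summits.AtomisticToContinuum.HydrodynamicLimit.Theorems.CollisionIsometryCLTMacroClosureStubLedgerScaling
import HarnessLib

/-!
# The reference local Gibbs law at time zero is the initial law (stub `stub_timeZeroReference`)

Crux `Summit.AtomisticToContinuum.HydrodynamicLimit.Theses.OneFlightGossipEngine.ClampedCurrentsDock`
(stmt-AtomisticToContinuum-14680), line `IdeatorTwoSketch`, stub `stub_timeZeroReference : TimeZeroReference`.
Yau's relative-entropy clock runs along the reference local Gibbs laws `ψ_s` with activity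
`a_s = ρ_s · Rf(σ³ρ_s)` (`Rf` the insertion factor of the activity inversion, handed over with the four
defining properties of `stub_eosRatioAnalytic`); at `s = 0` the Euler density is the LLN density
`ρ₀ = rhoLim (profileOf a₀) σ` of the initial activity profile `a₀`, and the ledger needs `H_N(0) = 0`, i.e.
`ψ₀ = λ_N`. `TimeZeroReference` is re-declared verbatim from the line skeleton
`Cruxes/ClampedCurrentsDock/Lines/IdeatorTwoSketch.lean`.

## Proof

By `R2OneModeTwoConditions.eosIdentityForRhoLim`, for small `σ` there is a constant `c` with
`log ρ₀(x) + βμ_ex(ρ₀(x)σ³) = log a₀(x) + c` for all `x`; by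
`R2OneModeTwoConditions.excessChemicalPotential_eq_log`, `βμ_ex(η) = log Rf₁(η)` for `0 < η < η₁`, where
`Rf₁ x` is the unique root in `[1/2, 2]` of `R · Φ(xR) = 1` (`Φ(u) = Σ_j bE j uʲ/j!`). The handed-over `Rf`
solves that equation with `1 ≤ Rf ≤ 2` on `[0, r]`, so `Rf = Rf₁` on `(0, min η₁ r)`. The reduced density
`ρ₀(x)σ³` lies in that interval once `σ < min 1 (min η₁ r / K)`, `K = (2e+1)M` being the uniform bound
`rhoLim < K` (`DenseExcursionAtTimeZero.rhoLim_lt`) under `SmallDensity` (`exists_smallDensity`, which also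
gives `ρ₀ > 0`). Exponentiating, `ρ₀(x) · Rf(σ³ρ₀(x)) = e^c · a₀(x)` for every `x`, and the canonical local
Gibbs law is invariant under scaling of the activity by the positive constant `e^c`
(`MacroClosureLine.StubLedger.localGibbsLaw_const_mul`).
-/

noncomputable section

open MeasureTheory Filter Set Topology
open Literature.MathematicalPhysics.KineticTheory Literature.Analysis.FluidPDE Literature.Analysis.FunctionSpaces

namespace Summit.AtomisticToContinuum.HydrodynamicLimit.Theorems.ClampedCurrentsDockTimeZero

open R2OneModeTwoConditions DenseExcursionAtTimeZero MacroClosureLine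

/-! ## The statement (verbatim from the line skeleton) -/

/-- **S9 — the reference at time zero IS the initial law.** For a continuous positive activity profile `a₀` (with any
`u₀, θ₀`) and every insertion factor `Rf` handed over with the four defining properties of `stub_eosRatioAnalytic`, at
all small `σ` the explicit reference activity of the ledger built on the LLN density `ρ₀ = rhoLim (profileOf a₀) σ`,
namely `x ↦ ρ₀(x)·Rf(σ³ρ₀(x))`, is a CONSTANT multiple of `a₀` (`eosIdentityForRhoLim`: `log ρ₀ + βμ_ex(ρ₀σ³) =
log a₀ + c`, and `e^{βμ_ex} = Rf` by `excessChemicalPotential_eq_log` + uniqueness of the root), hence defines the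
SAME canonical local Gibbs law (`localGibbsLaw_const_mul`): `H_N(0) = KL(λ_N ‖ ψ₀) = 0` for the ledger. -/
def TimeZeroReference : Prop :=
  ∀ (a₀ θ₀ : T3 → ℝ) (u₀ : T3 → V3) (ha : Continuous a₀) (ha0 : ∀ x, 0 < a₀ x) (r : ℝ) (Rf : ℝ → ℝ), 0 < r →
    (∀ x ∈ Ioo (-r) r, 0 < Rf x ∧ Rf x * (∑' j : ℕ, bE j / (j.factorial : ℝ) * (x * Rf x) ^ j) = 1) →
    (∀ x ∈ Icc 0 r, 1 ≤ Rf x ∧ Rf x ≤ 2) → ContinuousOn Rf (Icc 0 r) →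
    (∀ x ∈ Ioo (-r) r, ∀ R ∈ Icc (1 / 2 : ℝ) 2,
      R * (∑' j : ℕ, bE j / (j.factorial : ℝ) * (x * R) ^ j) = 1 → R = Rf x) →
    ∃ σ₀ : ℝ, 0 < σ₀ ∧ ∀ σ : ℝ, 0 < σ → σ < σ₀ →
      ∀ (N : ℕ) (Φ : HardSphereFlow (Torus.geometry (Fin 3)) (hsDiameter σ N) (N + 1)),
        localGibbsLaw σ (fun x => rhoLim (profileOf a₀ ha ha0) σ x * Rf (σ ^ 3 * rhoLim (profileOf a₀ ha ha0) σ x))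
            u₀ θ₀ N Φ = localGibbsLaw σ a₀ u₀ θ₀ N Φ

/-! ## The reference activity at time zero is a constant multiple of the initial activity -/

/-- **`ρ₀ · Rf(σ³ρ₀) = C · a₀` pointwise, `C > 0`.** For a continuous positive activity profile `a₀` and an
insertion factor `Rf` on `(−r, r)` (a positive root of `Rf x · Φ(x Rf x) = 1` with `1 ≤ Rf ≤ 2` on `[0, r]`),
for all small `σ` the reference activity `x ↦ ρ₀(x) · Rf(σ³ρ₀(x))` built on the LLN density
`ρ₀ = rhoLim (profileOf a₀) σ` is the constant multiple `e^c · a₀` of `a₀`, `c` the constant of the EOS identity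
`log ρ₀ + βμ_ex(ρ₀σ³) = log a₀ + c` (`eosIdentityForRhoLim`), because `βμ_ex = log Rf` on the range of `ρ₀σ³`
(`excessChemicalPotential_eq_log` and uniqueness of the root in `[1/2, 2]`). [folklore] -/
theorem rhoLim_mul_insertionFactor_eq_const_mul {a₀ : T3 → ℝ} (ha : Continuous a₀) (ha0 : ∀ x, 0 < a₀ x)
    {r : ℝ} {Rf : ℝ → ℝ} (hr : 0 < r)
    (hsol : ∀ x ∈ Ioo (-r) r, 0 < Rf x ∧ Rf x * (∑' j : ℕ, bE j / (j.factorial : ℝ) * (x * Rf x) ^ j) = 1)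
    (hbd : ∀ x ∈ Icc 0 r, 1 ≤ Rf x ∧ Rf x ≤ 2) :
    ∃ σ₀ : ℝ, 0 < σ₀ ∧ ∀ σ : ℝ, 0 < σ → σ < σ₀ → ∃ C : ℝ, 0 < C ∧
      ∀ x, rhoLim (profileOf a₀ ha ha0) σ x * Rf (σ ^ 3 * rhoLim (profileOf a₀ ha ha0) σ x) = C * a₀ x := by
  obtain ⟨σe, hσe, He⟩ := eosIdentityForRhoLim a₀ ha ha0
  obtain ⟨η₁, hη₁, Rf₁, hμ, huniq₁⟩ := excessChemicalPotential_eq_log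
  set P := profileOf a₀ ha ha0 with hP
  -- smallness: `SmallDensity P σ` and the positivity margin `4eMθ/(1-θ) < min β`
  obtain ⟨x₀, -, hx₀⟩ := isCompact_univ.exists_isMinOn univ_nonempty P.continuous.continuousOn
  have hβmin : ∀ y, P.β x₀ ≤ P.β y := fun y => (isMinOn_iff.mp hx₀) y (mem_univ y)
  obtain ⟨σa, hσa, Ha⟩ := exists_smallDensity P (P.pos x₀)
  -- the uniform bound `rhoLim < K`
  set K := (2 * Real.exp 1 + 1) * P.M with hK
  have hM := P.M_pos
  have hK0 : 0 < K := by positivity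
  -- the common range `(0, η)` of the two insertion factors `Rf`, `Rf₁`
  set η := min η₁ r with hη
  have hη0 : 0 < η := lt_min hη₁ hr
  refine ⟨min σe (min σa (min 1 (η / K))),
    lt_min hσe (lt_min hσa (lt_min one_pos (div_pos hη0 hK0))), fun σ hσ hσlt => ?_⟩
  have hσe' : σ < σe := lt_of_lt_of_le hσlt (min_le_left _ _)
  have hσa' : σ < σa := lt_of_lt_of_le hσlt ((min_le_right _ _).trans (min_le_left _ _))
  have hσ1 : σ < 1 :=
    lt_of_lt_of_le hσlt ((min_le_right _ _).trans ((min_le_right _ _).trans (min_le_left _ _)))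
  have hσK : σ < η / K :=
    lt_of_lt_of_le hσlt ((min_le_right _ _).trans ((min_le_right _ _).trans (min_le_right _ _)))
  obtain ⟨h, hposm⟩ := Ha σ hσ hσa'
  have hpos : ∀ x, 0 < rhoLim P σ x := fun x => h.rhoLim_pos (hposm.trans_le (hβmin x))
  obtain ⟨c, hc⟩ := He σ hσ hσe'
  refine ⟨Real.exp c, Real.exp_pos c, fun x => ?_⟩
  -- `y := ρ₀(x) σ³ ∈ (0, η)`
  have hσ3 : σ ^ 3 ≤ σ := by
    have e : σ ^ 3 = σ * (σ * σ) := by ring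
    rw [e]; exact mul_le_of_le_one_right hσ.le (by nlinarith)
  have hmem : rhoLim P σ x * σ ^ 3 ∈ Ioo 0 η := by
    refine ⟨mul_pos (hpos x) (pow_pos hσ 3), ?_⟩
    have h1 : rhoLim P σ x < K := rhoLim_lt h x
    calc rhoLim P σ x * σ ^ 3 ≤ K * σ ^ 3 := mul_le_mul_of_nonneg_right h1.le (pow_pos hσ 3).le
      _ ≤ K * σ := by gcongr
      _ < K * (η / K) := by gcongr
      _ = η := mul_div_cancel₀ η hK0.ne'
  have hy₁ : rhoLim P σ x * σ ^ 3 ∈ Ioo 0 η₁ := ⟨hmem.1, hmem.2.trans_le (min_le_left _ _)⟩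
  have hyr : rhoLim P σ x * σ ^ 3 ∈ Ioo (-r) r := ⟨by linarith [hmem.1], hmem.2.trans_le (min_le_right _ _)⟩
  have hyc : rhoLim P σ x * σ ^ 3 ∈ Icc 0 r := ⟨hmem.1.le, hyr.2.le⟩
  -- `Rf = Rf₁` at `y` (uniqueness of the root in `[1/2, 2]`)
  have hRf : Rf (rhoLim P σ x * σ ^ 3) = Rf₁ (rhoLim P σ x * σ ^ 3) :=
    huniq₁ _ hy₁ _ ⟨by linarith [(hbd _ hyc).1], (hbd _ hyc).2⟩ (hsol _ hyr).2
  have hRfpos : 0 < Rf (rhoLim P σ x * σ ^ 3) := (hsol _ hyr).1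
  -- the EOS identity at `x`, with `βμ_ex = log Rf`
  have hx := hc x
  rw [hμ _ hy₁, ← hRf] at hx
  calc rhoLim P σ x * Rf (σ ^ 3 * rhoLim P σ x)
      = Real.exp (Real.log (rhoLim P σ x) + Real.log (Rf (rhoLim P σ x * σ ^ 3))) := by
        rw [Real.exp_add, Real.exp_log (hpos x), Real.exp_log hRfpos, mul_comm (σ ^ 3)]
    _ = Real.exp c * a₀ x := by rw [hx, Real.exp_add, Real.exp_log (ha0 x), mul_comm]

/-! ## The stub -/

/-- **STUB `stub_timeZeroReference`** of line `IdeatorTwoSketch` (crux `ClampedCurrentsDock`,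
stmt-AtomisticToContinuum-14680): the reference local Gibbs law at time zero, with activity
`ρ₀ · Rf(σ³ρ₀)`, `ρ₀ = rhoLim (profileOf a₀) σ`, IS the initial local Gibbs law of activity `a₀` — the reference
activity is the constant multiple `e^c · a₀` (`rhoLim_mul_insertionFactor_eq_const_mul`) and the canonical local
Gibbs law is invariant under scaling of the activity (`localGibbsLaw_const_mul`). [folklore] -/
theorem stub_timeZeroReference : TimeZeroReference := by
  intro a₀ θ₀ u₀ ha ha0 r Rf hr hsol hbd _hcont _huniq
  obtain ⟨σ₀, hσ₀, H⟩ := rhoLim_mul_insertionFactor_eq_const_mul ha ha0 hr hsol hbd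
  refine ⟨σ₀, hσ₀, fun σ hσ hσlt N Φ => ?_⟩
  obtain ⟨C, hC, hCx⟩ := H σ hσ hσlt
  have hfun : (fun x => rhoLim (profileOf a₀ ha ha0) σ x * Rf (σ ^ 3 * rhoLim (profileOf a₀ ha ha0) σ x)) =
      fun x => C * a₀ x := funext hCx
  rw [hfun]
  exact StubLedger.localGibbsLaw_const_mul Φ a₀ θ₀ u₀ hC

end Summit.AtomisticToContinuum.HydrodynamicLimit.Theorems.ClampedCurrentsDockTimeZero

end
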